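import Literature.NumberTheory.EllipticCurves.KramerTunnell1982.NormIndexExactSequenceProofs
import Literature.NumberTheory.EllipticCurves.ReductionHomomorphismSurjectiveProofs
import HarnessLib

/-!
# Kramer–Tunnell 1982, §6: `Ĥ⁰ = H¹ = 0` on `E⁰(K)` from the reduction sequence
`0 → E₁(K) → E⁰(K) → Ẽ_ns(k) → 0`

K. Kramer, J. Tunnell, *Elliptic curves and local ε-factors*, Compositio Math. **46** (1982),
§6 (p. 327): "Let `E⁰` be the connected component of the identity in the Néron minimal model for
`E`.  It follows from Lang's theorem [9] that `N : E⁰(K) → E⁰(F)` is surjective."  The printed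
argument: Lang's theorem gives `Ĥ⁰ = H¹ = 0` for `Gal(k'/k)` on the connected group `Ẽ_ns(k')`;
the kernel of reduction `E₁(K)` is cohomologically trivial (formal group); the exact sequence
`0 → E₁(K) → E⁰(K) → Ẽ_ns(k) → 0` (Silverman *AEC* VII.2.1, surjective since `K` is henselian)
then gives the same vanishing for `E⁰(K)`.

This file is that deduction, for a Weierstrass equation `W` over a henselian local ring `R`
(integers of a valuation of the field `K`) in the vocabulary of the tree's `ReductionHomomorphism`
(`WeierstrassCurve.HasNonsingularReduction` = `P ∈ E⁰`, `WeierstrassCurve.ReducesToZero` = `P ∈ E₁`,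
`WeierstrassCurve.reducePoint`, `WeierstrassCurve.reductionHom`, `reductionHom_surjective`), for an
additive involution `s` of `E(K)` preserving `E⁰(K)` and compatible with an additive map `t` of
`Ẽ_ns(k)` under reduction (`(sP)~ = t P̃` on `E⁰`) — e.g. `s = σ ∈ Gal(K/F)` acting on
coordinates and `t = σ̄` — given the two inputs as hypotheses:
(A) `Ĥ⁰ = H¹ = 0` for `s` on `E₁(K)` (the tree's `KramerTunnell1982/KernelReductionNormProofs`
in the unramified quadratic case) and (C) `Ĥ⁰ = H¹ = 0` for `t` on `Ẽ_ns(k)` (Lang; the tree's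
`FiniteFieldQuadraticLangProofs` for good reduction):

* `exists_add_eq_of_hasNonsingularReduction` — every `s`-fixed `P ∈ E⁰(K)` is `Q + sQ` with
  `Q ∈ E⁰(K)`;
* `exists_sub_eq_of_hasNonsingularReduction` — every `P ∈ E⁰(K)` with `P + sP = O` is `sQ - Q`
  with `Q ∈ E⁰(K)`.

Both are the surjection form of the exact hexagon (`NormIndexExactSequenceProofs` §4) applied to
`reductionHom`.  Theorems only: no definition, no named fact, no `sorry` (D-0026: net debt `0`).

## References

* [KramerTunnell1982] K. Kramer, J. Tunnell, Compositio Math. 46 (1982), §6 p. 327.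
* [SilvermanAEC2009] J. H. Silverman, *The Arithmetic of Elliptic Curves*, VII.2 Prop. 2.1
  (the exact sequence `0 → E₁(K) → E₀(K) → Ẽ_ns(k) → 0`).
* [SerreLocalFields1979] J.-P. Serre, *Local Fields*, Ch. VIII §4 (exact hexagon).
-/

noncomputable section

open scoped Classical

namespace Literature.NumberTheory.EllipticCurves.KramerTunnell1982

section Reduction

variable {R : Type*} [CommRing R] [IsLocalRing R] {K : Type*} [Field K] [Algebra R K]
  {Γ₀ : Type*} [LinearOrderedCommGroupWithZero Γ₀] {v : Valuation K Γ₀} (hv : v.Integers R)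
  [HenselianRing R (IsLocalRing.maximalIdeal R)] (W : WeierstrassCurve R)
  (s : (W.baseChange K).toAffine.Point →+ (W.baseChange K).toAffine.Point)
  (t : (W.map (IsLocalRing.residue R)).toAffine.Point →+ (W.map (IsLocalRing.residue R)).toAffine.Point)
  (hss : ∀ P, s (s P) = P)
  (hsE : ∀ P, W.HasNonsingularReduction P → W.HasNonsingularReduction (s P))
  (hst : ∀ P, W.HasNonsingularReduction P → W.reducePoint (s P) = t (W.reducePoint P))

include hv hsE hss hst in
/-- **`Ĥ⁰(⟨s⟩, E⁰(K)) = 0`** from `Ĥ⁰(E₁) = 0` and `Ĥ⁰(Ẽ_ns(k)) = 0`: every `s`-fixed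
point with nonsingular reduction is `Q + sQ` for some `Q` with nonsingular reduction.
Kramer–Tunnell: "It follows from Lang's theorem [9] that `N : E⁰(K) → E⁰(F)` is surjective";
assembled through the surjective reduction homomorphism `E⁰(K) → Ẽ_ns(k)` with kernel `E₁(K)`
(Silverman VII.2.1; `R` henselian) and the exact hexagon (`exists_add_eq_of_surjective`).
[cite: KramerTunnell1982, §6 p. 327 ("N : E⁰(K) → E⁰(F) is surjective")] -/
theorem exists_add_eq_of_hasNonsingularReduction
    (h0A : ∀ P, W.ReducesToZero P → s P = P →
      ∃ Q, W.ReducesToZero Q ∧ Q + s Q = P)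
    (h0C : ∀ c : (W.map (IsLocalRing.residue R)).toAffine.Point, t c = c → ∃ y, y + t y = c)
    {P : (W.baseChange K).toAffine.Point} (hP : W.HasNonsingularReduction P) (hfix : s P = P) :
    ∃ Q : (W.baseChange K).toAffine.Point, W.HasNonsingularReduction Q ∧ Q + s Q = P := by
  -- the data of the surjection form of the hexagon
  set E0 := W.nonsingularReductionSubgroup hv with hE0
  set π := W.reductionHom hv with hπdef
  obtain ⟨s', hs'⟩ : ∃ s' : E0 →+ E0, ∀ b : E0,
      ((s' b : E0) : (W.baseChange K).toAffine.Point) = s b :=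
    ⟨(s.comp E0.subtype).codRestrict E0 (fun b => hsE b b.2), fun b => rfl⟩
  have hπs : ∀ b : E0, π (s' b) = t (π b) := fun b => by
    rw [hπdef, WeierstrassCurve.reductionHom_apply, WeierstrassCurve.reductionHom_apply,
      hs']
    exact hst _ b.2
  have hss' : ∀ b : E0, s' (s' b) = b := fun b =>
    Subtype.ext (by rw [hs', hs', hss])
  have hker : ∀ a : E0, π a = 0 ↔ W.ReducesToZero (a : (W.baseChange K).toAffine.Point) :=
    fun a => by
      rw [hπdef, WeierstrassCurve.reductionHom_apply]
      exact WeierstrassCurve.reducePoint_eq_zero_iff hv a.2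
  have h0A' : ∀ a : E0, π a = 0 → s' a = a →
      ∃ a' : E0, π a' = 0 ∧ a' + s' a' = a := by
    intro a ha hfa
    obtain ⟨Q, hQ, hQa⟩ := h0A _ ((hker a).mp ha) (by
      have h := congrArg (fun x : E0 => (x : (W.baseChange K).toAffine.Point)) hfa
      simpa only [hs'] using h)
    refine ⟨⟨Q, hQ.hasNonsingularReduction⟩, (hker _).mpr hQ, Subtype.ext ?_⟩
    simpa only [AddSubgroup.coe_add, hs'] using hQa
  obtain ⟨x, hx⟩ := exists_add_eq_of_surjective (s') t π hπs hss'
    (WeierstrassCurve.reductionHom_surjective W hv) h0A' (b := ⟨P, hP⟩)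
    (Subtype.ext (by rw [hs']; exact hfix))
    (h0C _ (by
      have h := hπs ⟨P, hP⟩
      rw [show s' ⟨P, hP⟩ = ⟨P, hP⟩ from
        Subtype.ext (by rw [hs']; exact hfix)] at h
      exact h.symm))
  refine ⟨x, x.2, ?_⟩
  have h := congrArg (fun y : E0 => (y : (W.baseChange K).toAffine.Point)) hx
  simpa only [AddSubgroup.coe_add, hs'] using h

include hv hsE hss hst in
/-- **`H¹(⟨s⟩, E⁰(K)) = 0`** from `H¹(E₁) = 0` and `H¹(Ẽ_ns(k)) = 0`: every point `P` with
nonsingular reduction and `P + sP = O` is `sQ - Q` for some `Q` with nonsingular reduction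
(Kramer–Tunnell: "`|H¹(G, E⁰(K))| = 1`", via the surjective reduction homomorphism and the exact
hexagon, `exists_sub_eq_of_surjective`).
[cite: KramerTunnell1982, §6 proof of Lemma 6.1 (p. 327), |H¹(G, E⁰(K))| = 1] -/
theorem exists_sub_eq_of_hasNonsingularReduction
    (h1A : ∀ P, W.ReducesToZero P → P + s P = 0 →
      ∃ Q, W.ReducesToZero Q ∧ s Q - Q = P)
    (h1C : ∀ c : (W.map (IsLocalRing.residue R)).toAffine.Point, c + t c = 0 → ∃ y, t y - y = c)
    {P : (W.baseChange K).toAffine.Point} (hP : W.HasNonsingularReduction P) (hP0 : P + s P = 0) :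
    ∃ Q : (W.baseChange K).toAffine.Point, W.HasNonsingularReduction Q ∧ s Q - Q = P := by
  set E0 := W.nonsingularReductionSubgroup hv with hE0
  set π := W.reductionHom hv with hπdef
  obtain ⟨s', hs'⟩ : ∃ s' : E0 →+ E0, ∀ b : E0,
      ((s' b : E0) : (W.baseChange K).toAffine.Point) = s b :=
    ⟨(s.comp E0.subtype).codRestrict E0 (fun b => hsE b b.2), fun b => rfl⟩
  have hπs : ∀ b : E0, π (s' b) = t (π b) := fun b => by
    rw [hπdef, WeierstrassCurve.reductionHom_apply, WeierstrassCurve.reductionHom_apply,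
      hs']
    exact hst _ b.2
  have hss' : ∀ b : E0, s' (s' b) = b := fun b =>
    Subtype.ext (by rw [hs', hs', hss])
  have hker : ∀ a : E0, π a = 0 ↔ W.ReducesToZero (a : (W.baseChange K).toAffine.Point) :=
    fun a => by
      rw [hπdef, WeierstrassCurve.reductionHom_apply]
      exact WeierstrassCurve.reducePoint_eq_zero_iff hv a.2
  have h1A' : ∀ a : E0, π a = 0 → a + s' a = 0 →
      ∃ a' : E0, π a' = 0 ∧ s' a' - a' = a := by
    intro a ha hfa
    obtain ⟨Q, hQ, hQa⟩ := h1A _ ((hker a).mp ha) (by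
      have h := congrArg (fun x : E0 => (x : (W.baseChange K).toAffine.Point)) hfa
      simpa only [AddSubgroup.coe_add, hs', AddSubgroup.coe_zero] using h)
    refine ⟨⟨Q, hQ.hasNonsingularReduction⟩, (hker _).mpr hQ, Subtype.ext ?_⟩
    simpa only [AddSubgroup.coe_sub, hs'] using hQa
  obtain ⟨x, hx⟩ := exists_sub_eq_of_surjective (s') t π hπs hss'
    (WeierstrassCurve.reductionHom_surjective W hv) h1A' h1C (b := ⟨P, hP⟩)
    (Subtype.ext (by
      simp only [AddSubgroup.coe_add, hs', AddSubgroup.coe_zero]; exact hP0))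
  refine ⟨x, x.2, ?_⟩
  have h := congrArg (fun y : E0 => (y : (W.baseChange K).toAffine.Point)) hx
  simpa only [AddSubgroup.coe_sub, hs'] using h

end Reduction

end Literature.NumberTheory.EllipticCurves.KramerTunnell1982

end
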